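import Literature.MathematicalPhysics.QuantumFieldTheory.Balaban1983to89.B4Lemma22ZeroBoxLpLq

/-!
# `Balaban1983to89.B4Lemma22ZeroBoxSharp` — THE EXPONENT CONDITION «p₁ > d» OF B4 LEMMA 2.2 (2.17) IS SHARP AT
# ZERO FIELD: b04's TYPED `B4.Lemma22Printed (cubeFam ℓ m²₊ a Mb K) d'` HOLDS ON THE ZERO-FIELD BOX FAMILY IF AND
# ONLY IF `d' ≥ d + 1` (THE LATTICE DIMENSION)

**Source.** T. Bałaban, *Regularity and Decay of Lattice Green's Functions*, Commun. Math. Phys. **89**, 571–597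
(1983) (bib key `Balaban1983RegularityDecay`, «B4»): pp. 577–578 [PDF 7–8] Lemma 2.2 with (2.16)–(2.17); p. 572
[PDF 2] the operator (1.6); p. 583 [PDF 13] the proof of (2.17) for `G_k(□)` (journal page = PDF page + 570).
Quoted from the page renders `b2b-balaban-ref1/pages/1983-cmp89-regularity-decay/1983-cmp89-regularity-decay-p002-x2.png`,
`…-p007-x2.png`, `…-p008-x2.png`, `…-p013-x2.png` (not from the OCR text); the print's `≦` is written `≤`.

## WHAT IS PRINTED (verbatim from the renders)

pp. 577–578, Lemma 2.2: «Let a rectangular parallelepiped □ be a sum of few large blocks (e.g., as in the case of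
the cubes □_j), and let Ã be a regular vector field configuration in the sense of Proposition I.2.1, constant in a
neighbourhood of the boundary of □. Then for e sufficiently small and α < 1, there exists a constant c₁ depending on
d, α only, such that ‖G_k(□,Ã)f‖_{1,α} ≤ c₁‖f‖_∞, (2.16) and a constant c₂ depending on d, p₁, such that
‖G_k(□,Ã)f‖_q, ‖D^η_{Ã,μ}G_k(□,Ã)f‖_q, ‖G_k(□,Ã)D^{η*}_{Ã,μ}f‖_q ≤ c₂‖f‖_p (2.17) for 1 ≤ p, q ≤ ∞, satisfying
the condition 1/p − 1/p₁ ≤ 1/q ≤ 1/p with p₁ > d.»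

p. 583: «Now we will prove that the operators G_k(□), ∂^η_μG_k(□), G_k(□)∂^{η*}_μ are bounded operators from
L^{p₁}(□) with p₁ > d to L^∞(□). […] ≤ O(1)η^{1−d/p₁}‖f‖_{p₁} + Σ_{j=1}^{k−1} O(1)(L^jη)^{1−d/p₁}‖f‖_{p₁}
≤ c′₂‖f‖_{p₁} (2.41) for x ∈ □, p₁ > d, where the constant c′₂ is built of c₀, Σ_{x∈Z^d} e^{−δ₀|x|},
Σ_{j=1}^∞ (L^{−j})^{1−d/p₁}.»  The print's `d` is the number of dimensions of the lattice: p. 572 [PDF 2] «We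
consider operators on subsets of the lattice ηZ^d, η = L^{−k}.» and (1.1) «B^k(y) = Δ(y) = {x∈ηZ^d : y_μ ≤ x_μ <
y_μ + 1, μ = 1, ..., d}, y∈Z^d.» (render `…-p002-x2.png`); in this package the lattice is `Fin (d+1) → ℤ`, of
dimension `d + 1`, so the print's `d` is this package's `d + 1`.

## WHAT IS CERTIFIED (HONEST SCOPE)

b04's TYPED LEAF `B4.Lemma22Printed (fam : I → CubeSetting) (d' : ℕ)` carries the printed «p₁ > d» as the free
parameter `d'` (conjunct 2 reads `∀ p₁ : ℝ, (d' : ℝ) < p₁ → ∃ c₂ e₁ > 0, ∀ i, rect → fewLargeBlocks → regular →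
constNearBdry → 0 < e → e ≤ e₁ → ∀ s t n μ f, 0 ≤ t → s ≤ 1 → s − 1/p₁ ≤ t → t ≤ s → ‖Y_n f‖_{1/t} ≤ c₂‖f‖_{1/s}`
in the `η`-weighted norms `ZeroFieldCube.lpN` of (2.11)).  Node 19 (`B4Lemma22ZeroBoxLpLq.lemma22Printed_cubeFam`)
discharged it VERBATIM at `Ã = 0` on the ZERO-FIELD BOX FAMILY `cubeFam ℓ m²₊ a Mb K : BoxInst d ℓ m²₊ →
CubeSetting` of node 15 (every scale `k ≥ 1`, every box `Π_μ[0,M_μ)`, every mass `m² ∈ [0, m²₊]`, every charge)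
with the FAITHFUL parameter `d' = d + 1` = the lattice dimension = the print's `d`.  THIS LEAF DECIDES THE TYPED
STATEMENT IN ITS PARAMETER:

* `lemma22Printed_cubeFam_iff` — for `d ≥ 1` (lattice dimension `d + 1 ≥ 2`), `L = ℓ + 1 ≥ 2`, `a > 0`,
  `0 ≤ m²₊`, `Mb ≥ 1`, `K ≥ 1` and every `d' : ℕ`:
  `Lemma22Printed (cubeFam ℓ m²₊ a Mb K) d' ↔ d + 1 ≤ d'`.
  (`←`: node 19 and the monotonicity `lemma22Printed_mono` of the leaf in `d'`; `→`: `not_lemma22Printed_cubeFam`.)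
* `not_lemma22Printed17_cubeFam` — THE NEW, NEGATIVE HALF: for every `d' ≤ d`, CONJUNCT 2 of the typed leaf is
  FALSE on this family.  At `p₁ = d + 1/2 ∈ (d', d + 1)` no constant `c₂` can serve all scales: take the member
  «the cube `[0, Mb)^{d+1}` of ONE large block, mass `m² = 0`, charge `e₁`, scale `k`» (node 12's `BoxInst.cube`; it
  meets all six typed antecedents, node 15's `cube_hypothesesC`), the corner `x₀ = 0` and `f = δ_{x₀}`.  The clause
  at `(1/p, 1/q) = (1, 1)` for `Y = G_k` gives the column sum `Σ_y |G_k(y, x₀)| ≤ c₂`, and at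
  `(1/p, 1/q) = (1, 1 − 1/p₁)` for `Y = D^η_μ G_k` it gives `|(D^η_μ G_k δ_{x₀})(x)| ≤ (n^{d+1})^{1−1/p₁}·c₂ η^{d+1}`
  (`extract`; `n = L^k = η^{-1}`).  But the row `x₀` of `(n²(−Δ^N_□) + a n^{-(d+1)} 1_{blk · = blk x₀}) G_k = 1`
  — the operator (1.6) at `m² = 0` in lattice units, `B4BoxCov237.boxOpR` — reads
  `1 = n² Σ_{y ∼ x₀, y ∈ □} (G_k(x₀,x₀) − G_k(y,x₀)) + a n^{-(d+1)} Σ_{blk y = blk x₀} G_k(y,x₀)`, every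
  increment along a box bond is a value of `D^η_μ G_k δ_{x₀}` divided by `n`, and `x₀` has at most `2(d+1)` box
  neighbours, so `1 ≤ 2(d+1)·n·B + a n^{-(d+1)}·S` for any pointwise bound `B` on `|D^η_μ G_k δ_{x₀}|` and any
  bound `S` on the column sum (`core_ineq`).  With the typed `B` and `S` this is
  `1 ≤ 2(d+1)c₂·n^{1 − (d+1)/p₁} + a c₂ n^{-(d+1)} = 2(d+1)c₂·n^{−1/(2d+1)} + a c₂ n^{-(d+1)}` (`scale_identity`),
  which is `≤ 1/8 + 1/4` once `n = L^k ≥ max(4ac₂, (16(d+1)c₂)^{2d+1})` (`numerics`, `exists_scale`) — a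
  contradiction.  In words: `D^η_μ G_k δ_{x₀}` has a value `≳ η` next to the source while `‖δ_{x₀}‖₁ = η^{d+1}`, so
  `‖D^η_μ G_k‖_{L¹ → L^q} ≳ η^{1 − (d+1)(1 − 1/q)}`, unbounded as `η → 0` as soon as `1 − 1/q > 1/(d+1)`; the
  typed clause with `d' ≤ d` demands exactly such a bound at `1 − 1/q = 1/p₁`, `p₁ ∈ (d', d+1)`.
* consequences displayed: `not_lemma22Printed_cubeFam` (`¬ Lemma22Printed (cubeFam …) d'` for `d' ≤ d`),
  `lemma22Printed_cubeFam_of_le` (the leaf for every `d' ≥ d + 1`), `lemma22Printed_mono`.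

READING (for b04 / the carver).  (i) The print's hypothesis «p₁ > d» in (2.17) CANNOT BE WEAKENED: already at
`Ã = 0`, on a cube, for the derivative vector `D^η_μ G_k`, the `L^p → L^q` bound fails uniformly in `η` for every
`1/p − 1/q > 1/d_lattice` — the typed leaf is false for every parameter below the lattice dimension and true from
it on (on this family).  (ii) Hence the typed leaf MUST be instantiated with `d' = d + 1` when positions are
`Fin (d+1) → ℤ` (as node 19 does); an instantiation `Lemma22Printed fam d` with this package's index `d` would be a
false statement at zero field (`not_lemma22Printed_cubeFam … le_rfl`).  (iii) Nothing here bears on `Ã ≠ 0`, on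
regions other than boxes, or on Lemma 2.2's role in the paper; it is a statement about the typed leaf's parameter
and the sharpness of the printed exponent condition in the zero-field box case.

NOT CERTIFIED / NOT CLAIMED: anything at `Ã ≠ 0`; regions other than boxes; the case `d = 0` of this package (the
one-dimensional lattice `Fin 1 → ℤ`, where `D^η G_k` has a bounded kernel and the dichotomy is different — not
treated); optimality of the constants.  No published statement is contradicted: the print assumes «p₁ > d».

## ROUTE

Elementary: b04's definitions (`ZeroFieldCube.opY/lpN`, `B4Cor23Zero.fdiff`), node 15's dictionary
(`toZFC`, `cubeFam`, `green_eq_box : G = (boxOpR L^k a m² M)⁻¹`, `cube_hypothesesC`, `lemma22Printed_iff`), the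
row formula `B4BoxCov237.opBoxR_mulVec` and invertibility `boxOpR_mul_inv` of the lineage's real box operator, the
degree count `card_nbrs`, node 19's `lemma22Printed_cubeFam` for the converse, and real-exponent bookkeeping
(`Real.rpow_*`).  No cited fact is minted; no hypothesis is assumed; nothing of b04 or of nodes 6–19 is modified.
-/

namespace Literature.MathematicalPhysics.QuantumFieldTheory.Balaban1983to89.B4Lemma22ZeroBoxSharp

open Finset Matrix
open Literature.MathematicalPhysics.QuantumFieldTheory.Balaban1983to89.B4 (CubeSetting Lemma22Printed)
open Literature.MathematicalPhysics.QuantumFieldTheory.Balaban1983to89.B4Reflection242 (boxDom mem_boxDom nbrs mem_nbrs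
  card_nbrs)
open Literature.MathematicalPhysics.QuantumFieldTheory.Balaban1983to89.B4Green242Bridge (boxNbrs boxBlk card_boxNbrs)
open Literature.MathematicalPhysics.QuantumFieldTheory.Balaban1983to89.B4BoxCov237 (boxOpR opBoxR_mulVec boxOpR_mul_inv
  uvec)
open Literature.MathematicalPhysics.QuantumFieldTheory.Balaban1983to89.B4Cor23Zero (fdiff fdiff_of_mem)
open Literature.MathematicalPhysics.QuantumFieldTheory.Balaban1983to89.B4Ineq19ZeroBoxEta (BoxInst)
open Literature.MathematicalPhysics.QuantumFieldTheory.Balaban1983to89.B4Lemma21Zero (ZeroFieldCube zeroFieldCube)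
open Literature.MathematicalPhysics.QuantumFieldTheory.Balaban1983to89.B4Lemma22ZeroBoxCube (toZFC cubeFam
  green_eq_box lemma22Printed_iff lemma22Printed16_cubeFam cube_hypothesesC Lemma22Printed16 toZFC_n toZFC_R)
open Literature.MathematicalPhysics.QuantumFieldTheory.Balaban1983to89.B4Lemma22ZeroBoxLpLq (lemma22_17_zero_box
  lemma22Printed_cubeFam sum_rpow_eq_lpN lpN_nonneg rpow_inv_rpow')

noncomputable section

variable {d : ℕ}

/-! ## §1 Monotonicity of the typed leaf in its dimension parameter; the positive half-line `d' ≥ d+1` -/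

section Mono

variable {I : Type}

/-- the typed leaf is MONOTONE in its dimension parameter: a larger `d'` only shrinks the range `p₁ > d'` of
conjunct 2. [folklore] -/
theorem lemma22Printed_mono (fam : I → CubeSetting) {d₁ d₂ : ℕ} (h : d₁ ≤ d₂) :
    Lemma22Printed fam d₁ → Lemma22Printed fam d₂ := by
  rintro ⟨h16, h17⟩
  refine ⟨h16, fun p₁ hp => h17 p₁ (lt_of_le_of_lt ?_ hp)⟩
  exact_mod_cast h

variable {ℓ : ℕ} {m2plus : ℝ}

/-- hence node 19 gives the typed leaf on the zero-field box family for EVERY parameter `d' ≥ d+1`.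
[cite: Balaban1983RegularityDecay, Lemma 2.2 (2.16)–(2.17) pp. 577–578, case Ã = 0, □ a box] -/
theorem lemma22Printed_cubeFam_of_le (hℓ : 1 ≤ ℓ) (a : ℝ) (ha : 0 < a) (Mb K : ℕ) {d' : ℕ} (h : d + 1 ≤ d') :
    Lemma22Printed (cubeFam (d := d) ℓ m2plus a Mb K) d' :=
  lemma22Printed_mono _ h (lemma22Printed_cubeFam hℓ a ha Mb K)

end Mono

/-! ## §2 Elementary facts: the `η`-weighted norms at `p = 1`, a point value under the `L^q` norm, the delta function -/

section Norms

variable (i : ZeroFieldCube d)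

/-- `‖g‖₁ = η^{d+1} Σ_x |g x|`. [folklore] -/
theorem lpN_one (g : ↥i.R → ℝ) : i.lpN 1 g = (1 / (i.n : ℝ)) ^ (d + 1) * ∑ x, |g x| := by
  unfold ZeroFieldCube.lpN
  rw [if_neg one_ne_zero, Real.rpow_one, div_one]
  simp_rw [Real.rpow_one]

/-- a single point value is controlled by the `L^{1/t}` norm: `|g x| ≤ (n^{d+1})^t ‖g‖_{1/t}` (`t > 0`). [folklore] -/
theorem abs_le_lpN (g : ↥i.R → ℝ) {t : ℝ} (ht : 0 < t) (x : ↥i.R) :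
    |g x| ≤ ((i.n : ℝ) ^ (d + 1)) ^ t * i.lpN t g := by
  rw [← sum_rpow_eq_lpN i g ht]
  have h1 : |g x| = (|g x| ^ (1 / t)) ^ t := (rpow_inv_rpow' (abs_nonneg _) ht.ne').symm
  rw [h1]
  refine Real.rpow_le_rpow (Real.rpow_nonneg (abs_nonneg _) _) ?_ ht.le
  exact Finset.single_le_sum (f := fun y => |g y| ^ (1 / t)) (fun y _ => Real.rpow_nonneg (abs_nonneg _) _)
    (Finset.mem_univ x)

/-- the delta function has `Σ|δ_{x₀}| = 1`. [folklore] -/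
theorem sum_abs_single (x₀ : ↥i.R) : ∑ x, |(Pi.single x₀ (1 : ℝ) : ↥i.R → ℝ) x| = 1 := by
  rw [Finset.sum_eq_single x₀]
  · simp
  · intro y _ hy
    simp [hy]
  · intro h; exact absurd (Finset.mem_univ _) h

/-- `‖δ_{x₀}‖₁ = η^{d+1}`. [folklore] -/
theorem lpN_one_single (x₀ : ↥i.R) : i.lpN 1 (Pi.single x₀ (1 : ℝ)) = (1 / (i.n : ℝ)) ^ (d + 1) := by
  rw [lpN_one, sum_abs_single, mul_one]

/-- `(T δ_{x₀})(y) = T(y, x₀)`: a matrix applied to the delta function is its column. [folklore] -/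
theorem mulVec_single_apply {X : Type*} [Fintype X] [DecidableEq X] (T : Matrix X X ℝ) (x₀ y : X) :
    (T *ᵥ Pi.single x₀ (1 : ℝ)) y = T y x₀ := by
  simp [Matrix.mulVec, dotProduct, Pi.single_apply]

end Norms

/-! ## §3 The row `x₀` of `(−Δ^{η,N}_□ + aP_k)·G_k(□,0) = 1`: a lower bound forcing `|D_μ G_k δ_{x₀}| ≳ η` -/

section Core

variable {n : ℕ} {M : Fin (d + 1) → ℕ}

/-- the in-box degree is at most `2(d+1)`. [folklore] -/
theorem card_boxNbrs_le (N : Fin (d + 1) → ℕ) (x : ↥(boxDom N)) : (boxNbrs N x).card ≤ 2 * (d + 1) := by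
  rw [card_boxNbrs, ← card_nbrs x.1]
  exact Finset.card_filter_le _ _

/-- along a box bond the increment of `v` is a value of the bond-restricted forward difference divided by `n`:
for `y ∼ x₀` in the box, `|v x₀ − v y| ≤ B/n` whenever `|(D_μ v)(x)| ≤ B` for all `μ, x`. [folklore] -/
theorem nbr_increment_le (hn : 1 ≤ n) {N : Fin (d + 1) → ℕ} (v : ↥(boxDom N) → ℝ) {B : ℝ}
    (hB : ∀ (μ : Fin (d + 1)) (x : ↥(boxDom N)), |fdiff n (boxDom N) μ v x| ≤ B)
    (x₀ : ↥(boxDom N)) {y : ↥(boxDom N)} (hy : y ∈ boxNbrs N x₀) : |v x₀ - v y| ≤ B / n := by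
  have hn0 : (0 : ℝ) < n := by exact_mod_cast hn
  unfold boxNbrs at hy
  rw [Finset.mem_filter] at hy
  obtain ⟨μ, hμ | hμ⟩ := mem_nbrs.1 hy.2
  · -- `y = x₀ + e_μ`: the bond `⟨x₀, y⟩`
    have e1 : x₀.1 + uvec μ = y.1 := by rw [hμ]; rfl
    have hmem : x₀.1 + uvec μ ∈ boxDom N := by rw [e1]; exact y.2
    have hfd := fdiff_of_mem (n := n) (μ := μ) v (x := x₀) hmem
    have hyeq : (⟨x₀.1 + uvec μ, hmem⟩ : ↥(boxDom N)) = y := Subtype.ext e1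
    rw [hyeq] at hfd
    have h1 : v x₀ - v y = -(fdiff n (boxDom N) μ v x₀) / n := by
      rw [hfd]; field_simp; ring
    rw [h1, abs_div, abs_neg, Nat.abs_cast]
    exact div_le_div_of_nonneg_right (hB μ x₀) hn0.le
  · -- `y = x₀ − e_μ`: the bond `⟨y, x₀⟩`
    have e1 : y.1 + uvec μ = x₀.1 := by
      rw [hμ]; show x₀.1 - Pi.single μ 1 + Pi.single μ 1 = x₀.1; abel
    have hmem : y.1 + uvec μ ∈ boxDom N := by rw [e1]; exact x₀.2
    have hfd := fdiff_of_mem (n := n) (μ := μ) v (x := y) hmem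
    have hyeq : (⟨y.1 + uvec μ, hmem⟩ : ↥(boxDom N)) = x₀ := Subtype.ext e1
    rw [hyeq] at hfd
    have h1 : v x₀ - v y = fdiff n (boxDom N) μ v y / n := by
      rw [hfd]; field_simp
    rw [h1, abs_div, Nat.abs_cast]
    exact div_le_div_of_nonneg_right (hB μ y) hn0.le

/-- **THE CORE INEQUALITY.** For the box Green's function `G = (n²(−Δ^N_□) + aP)^{-1}` (mass `0`) and its column
`v = G(·, x₀) = Gδ_{x₀}`: the row `x₀` of `(n²(−Δ^N) + aP)G = 1` reads
`1 = n² Σ_{y∼x₀}(v x₀ − v y) + a n^{-(d+1)} Σ_{blk y = blk x₀} v y`, hence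
`1 ≤ 2(d+1)·n·B + a n^{-(d+1)} S` whenever `|D_μ v| ≤ B` pointwise and `Σ_y |v y| ≤ S`. [folklore] -/
theorem core_ineq (hn : 1 ≤ n) {a : ℝ} (ha : 0 < a) (hM : ∀ i, 1 ≤ M i)
    (x₀ : ↥(boxDom fun i => n * M i)) {B S : ℝ}
    (hB : ∀ (μ : Fin (d + 1)) (x : ↥(boxDom fun i => n * M i)),
      |fdiff n (boxDom fun i => n * M i) μ (fun y => (boxOpR n a 0 M)⁻¹ y x₀) x| ≤ B)
    (hS : ∑ y, |(boxOpR n a 0 M)⁻¹ y x₀| ≤ S) :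
    1 ≤ 2 * ((d : ℝ) + 1) * n * B + a * ((n : ℝ) ^ (d + 1))⁻¹ * S := by
  set v : ↥(boxDom fun i => n * M i) → ℝ := fun y => (boxOpR n a 0 M)⁻¹ y x₀ with hv
  have hn0 : (0 : ℝ) < n := by exact_mod_cast hn
  -- the row identity
  have hcol : v = (boxOpR n a 0 M)⁻¹ *ᵥ Pi.single x₀ (1 : ℝ) := by
    funext y; rw [mulVec_single_apply]
  have hrow : (boxOpR n a 0 M *ᵥ v) x₀ = 1 := by
    rw [hcol, Matrix.mulVec_mulVec, boxOpR_mul_inv hn ha le_rfl hM, Matrix.one_mulVec]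
    try simp
  have hexp : (boxOpR n a 0 M *ᵥ v) x₀ = ((n : ℝ) ^ 2) * (∑ y ∈ boxNbrs _ x₀, (v x₀ - v y))
      + (0 * v x₀ + a * ((n : ℝ) ^ (d + 1))⁻¹ * ∑ y ∈ boxBlk n _ x₀, v y) := by
    unfold boxOpR
    rw [opBoxR_mulVec]
  rw [hexp, zero_mul, zero_add] at hrow
  -- bound the two terms
  have hB0 : 0 ≤ B := le_trans (abs_nonneg _) (hB 0 x₀)
  have h1 : ∑ y ∈ boxNbrs _ x₀, (v x₀ - v y) ≤ 2 * ((d : ℝ) + 1) * (B / n) := by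
    calc ∑ y ∈ boxNbrs _ x₀, (v x₀ - v y) ≤ ∑ y ∈ boxNbrs _ x₀, |v x₀ - v y| :=
          Finset.sum_le_sum fun y _ => le_abs_self _
      _ ≤ ∑ y ∈ boxNbrs _ x₀, B / n := Finset.sum_le_sum fun y hy => nbr_increment_le hn v hB x₀ hy
      _ = (boxNbrs _ x₀).card * (B / n) := by rw [Finset.sum_const, nsmul_eq_mul]
      _ ≤ 2 * ((d : ℝ) + 1) * (B / n) := by
          refine mul_le_mul_of_nonneg_right ?_ (div_nonneg hB0 hn0.le)
          exact_mod_cast card_boxNbrs_le _ x₀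
  have h2 : ∑ y ∈ boxBlk n _ x₀, v y ≤ S := by
    calc ∑ y ∈ boxBlk n _ x₀, v y ≤ ∑ y ∈ boxBlk n _ x₀, |v y| := Finset.sum_le_sum fun y _ => le_abs_self _
      _ ≤ ∑ y, |v y| := Finset.sum_le_sum_of_subset_of_nonneg (Finset.subset_univ _) fun y _ _ => abs_nonneg _
      _ ≤ S := hS
  have hnD : 0 < ((n : ℝ) ^ (d + 1))⁻¹ := inv_pos.2 (pow_pos hn0 _)
  calc (1 : ℝ) = ((n : ℝ) ^ 2) * (∑ y ∈ boxNbrs _ x₀, (v x₀ - v y))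
        + a * ((n : ℝ) ^ (d + 1))⁻¹ * ∑ y ∈ boxBlk n _ x₀, v y := hrow.symm
    _ ≤ ((n : ℝ) ^ 2) * (2 * ((d : ℝ) + 1) * (B / n)) + a * ((n : ℝ) ^ (d + 1))⁻¹ * S := by
        gcongr
    _ = 2 * ((d : ℝ) + 1) * n * B + a * ((n : ℝ) ^ (d + 1))⁻¹ * S := by
        field_simp

end Core

/-! ## §4 Reading the two typed bounds off a member: the column sum and the difference quotient of `G_k δ_{x₀}` -/

section Extract

variable {ℓ : ℕ} {m2plus : ℝ}

/-- the operator `Y = G_k(□,0)` of the typed clause applied to `δ_{x₀}` is the column `G_k(·, x₀)`. [folklore] -/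
theorem opY_zero_single (a : ℝ) (i : ZeroFieldCube d) (μ : Fin (d + 1)) (x₀ : ↥i.R) :
    i.opY a 0 μ (Pi.single x₀ (1 : ℝ)) = fun y => (i.green a) y x₀ := by
  funext y
  simp [ZeroFieldCube.opY, mulVec_single_apply]

/-- the operator `Y = D^η_μ G_k(□,0)` of the typed clause applied to `δ_{x₀}` is the bond-restricted forward difference
of the column `G_k(·, x₀)`. [folklore] -/
theorem opY_one_single (a : ℝ) (i : ZeroFieldCube d) (μ : Fin (d + 1)) (x₀ : ↥i.R) :
    i.opY a 1 μ (Pi.single x₀ (1 : ℝ)) = fdiff i.n i.R μ (fun y => (i.green a) y x₀) := by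
  have h : (i.green a) *ᵥ Pi.single x₀ (1 : ℝ) = fun y => (i.green a) y x₀ := by
    funext y; exact mulVec_single_apply _ _ _
  simp [ZeroFieldCube.opY, h]

/-- **THE TWO TYPED BOUNDS, READ OFF.** If the (2.17)-clause holds for a zero-field cube instance with constant `c₂`
at `(p, q) = (1, 1)` for `G_k` and at `(1/p, 1/q) = (1, t)`, `t > 0`, for `D^η_μ G_k` (all `μ`), both on
`f = δ_{x₀}`, then the column `v = G_k(·,x₀)` has `Σ_y |v y| ≤ c₂` and `|(D_μ v)(x)| ≤ (n^{d+1})^t · c₂ η^{d+1}`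
for all `μ, x`. [folklore] -/
theorem extract (a : ℝ) (i : ZeroFieldCube d) {c₂ t : ℝ} (ht : 0 < t) (x₀ : ↥i.R)
    (hA : i.lpN 1 (i.opY a 0 0 (Pi.single x₀ 1)) ≤ c₂ * i.lpN 1 (Pi.single x₀ 1))
    (hB : ∀ μ : Fin (d + 1), i.lpN t (i.opY a 1 μ (Pi.single x₀ 1)) ≤ c₂ * i.lpN 1 (Pi.single x₀ 1)) :
    (∑ y, |(i.green a) y x₀| ≤ c₂) ∧
      ∀ (μ : Fin (d + 1)) (x : ↥i.R), |fdiff i.n i.R μ (fun y => (i.green a) y x₀) x|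
        ≤ ((i.n : ℝ) ^ (d + 1)) ^ t * (c₂ * (1 / (i.n : ℝ)) ^ (d + 1)) := by
  have hn : (0 : ℝ) < i.n := by exact_mod_cast i.hn
  have hη : 0 < (1 / (i.n : ℝ)) ^ (d + 1) := pow_pos (by positivity) _
  refine ⟨?_, fun μ x => ?_⟩
  · rw [opY_zero_single, lpN_one, lpN_one_single, mul_comm c₂] at hA
    exact le_of_mul_le_mul_left hA hη
  · have h := hB μ
    rw [opY_one_single, lpN_one_single] at h
    calc |fdiff i.n i.R μ (fun y => (i.green a) y x₀) x|
        ≤ ((i.n : ℝ) ^ (d + 1)) ^ t * i.lpN t (fdiff i.n i.R μ (fun y => (i.green a) y x₀)) :=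
          abs_le_lpN i _ ht x
      _ ≤ ((i.n : ℝ) ^ (d + 1)) ^ t * (c₂ * (1 / (i.n : ℝ)) ^ (d + 1)) :=
          mul_le_mul_of_nonneg_left h (Real.rpow_nonneg (pow_nonneg hn.le _) _)

end Extract

/-! ## §5 The exponent bookkeeping: `n · (n^{d+1})^{1−1/p₁} · n^{-(d+1)} = n^{−1/(2d+1)}` at `p₁ = d + 1/2` -/

section Exponents

/-- the scaling identity at `p₁ = d + 1/2`, `t = 1 − 1/p₁`: `N·(N^{d+1})^t·(N^{d+1})^{-1} = N^{−1/(2d+1)}`.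
[folklore] -/
theorem scale_identity {N : ℝ} (hN : 0 < N) (d : ℕ) :
    N * ((N ^ (d + 1)) ^ (1 - 1 / ((d : ℝ) + 1 / 2))) * (N ^ (d + 1))⁻¹
      = N ^ (-(((2 * d + 1 : ℕ) : ℝ)⁻¹)) := by
  have e1 : (N ^ (d + 1) : ℝ) = N ^ ((d : ℝ) + 1) := by
    rw [← Real.rpow_natCast]; push_cast; ring_nf
  have hexp : (1 : ℝ) + ((d : ℝ) + 1) * (1 - 1 / ((d : ℝ) + 1 / 2)) + -((d : ℝ) + 1)
      = -(((2 * d + 1 : ℕ) : ℝ)⁻¹) := by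
    have h1 : (d : ℝ) + 1 / 2 ≠ 0 := by positivity
    have h2 : ((2 * d + 1 : ℕ) : ℝ) ≠ 0 := by positivity
    push_cast at h2 ⊢
    field_simp
    ring
  rw [e1, ← Real.rpow_mul hN.le, ← Real.rpow_neg hN.le, ← hexp, Real.rpow_add hN, Real.rpow_add hN,
    Real.rpow_one]

/-- `N ≥ C^m`, `C > 0`, `m ≥ 1` ⇒ `N^{−1/m} ≤ 1/C`. [folklore] -/
theorem rpow_neg_inv_le {N C : ℝ} {m : ℕ} (hm : m ≠ 0) (hC : 0 < C) (hN : C ^ m ≤ N) :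
    N ^ (-((m : ℝ)⁻¹)) ≤ C⁻¹ := by
  have hN0 : 0 < N := lt_of_lt_of_le (pow_pos hC m) hN
  rw [Real.rpow_neg hN0.le]
  have h1 : C = (C ^ m) ^ ((m : ℝ)⁻¹) := (Real.pow_rpow_inv_natCast hC.le hm).symm
  have h2 : (C ^ m) ^ ((m : ℝ)⁻¹) ≤ N ^ ((m : ℝ)⁻¹) :=
    Real.rpow_le_rpow (pow_nonneg hC.le m) hN (inv_nonneg.2 (Nat.cast_nonneg m))
  rw [← h1] at h2
  exact inv_anti₀ hC h2

/-- every real threshold is passed by some scale `L^k`, `k ≥ 1` (`L ≥ 2`). [folklore] -/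
theorem exists_scale {ℓ : ℕ} (hℓ : 1 ≤ ℓ) (N₀ : ℝ) : ∃ k : ℕ, 1 ≤ k ∧ N₀ ≤ (((ℓ + 1) ^ k : ℕ) : ℝ) := by
  refine ⟨⌈N₀⌉₊ + 1, by omega, ?_⟩
  have h1 : N₀ ≤ (⌈N₀⌉₊ : ℝ) := Nat.le_ceil N₀
  have h2 : ⌈N₀⌉₊ + 1 < 2 ^ (⌈N₀⌉₊ + 1) := Nat.lt_two_pow_self
  have h3 : 2 ^ (⌈N₀⌉₊ + 1) ≤ (ℓ + 1) ^ (⌈N₀⌉₊ + 1) := Nat.pow_le_pow_left (by omega) _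
  have h4 : (⌈N₀⌉₊ : ℝ) ≤ (((ℓ + 1) ^ (⌈N₀⌉₊ + 1) : ℕ) : ℝ) := by
    exact_mod_cast (by omega : ⌈N₀⌉₊ ≤ (ℓ + 1) ^ (⌈N₀⌉₊ + 1))
  linarith

end Exponents

/-! ## §6 The refutation: conjunct 2 of the typed leaf FAILS on the zero-field box family for every `d' ≤ d` -/

section Refutation

variable {ℓ : ℕ} {m2plus : ℝ}

/-- the numerics: for `N ≥ max(1, 4ac₂, (16(d+1)c₂)^{2d+1})` the right-hand side of `core_ineq` with the typed
bounds is `≤ 1/8 + 1/4 < 1`. [folklore] -/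
theorem numerics (d : ℕ) {a c₂ N : ℝ} (ha : 0 < a) (hc : 0 < c₂) (hN1 : 1 ≤ N) (hNa : 4 * a * c₂ ≤ N)
    (hNb : (8 * (2 * ((d : ℝ) + 1)) * c₂) ^ (2 * d + 1) ≤ N) :
    2 * ((d : ℝ) + 1) * N * ((N ^ (d + 1)) ^ (1 - 1 / ((d : ℝ) + 1 / 2)) * (c₂ * (1 / N) ^ (d + 1)))
      + a * (N ^ (d + 1))⁻¹ * c₂ < 1 := by
  have hN0 : 0 < N := lt_of_lt_of_le one_pos hN1
  have hterm1 : 2 * ((d : ℝ) + 1) * N * ((N ^ (d + 1)) ^ (1 - 1 / ((d : ℝ) + 1 / 2)) * (c₂ * (1 / N) ^ (d + 1)))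
      ≤ 1 / 8 := by
    have e : 2 * ((d : ℝ) + 1) * N * ((N ^ (d + 1)) ^ (1 - 1 / ((d : ℝ) + 1 / 2)) * (c₂ * (1 / N) ^ (d + 1)))
        = 2 * ((d : ℝ) + 1) * c₂ * (N * (N ^ (d + 1)) ^ (1 - 1 / ((d : ℝ) + 1 / 2)) * (N ^ (d + 1))⁻¹) := by
      rw [one_div N, inv_pow]; ring
    rw [e, scale_identity hN0 d]
    have hsm : N ^ (-(((2 * d + 1 : ℕ) : ℝ)⁻¹)) ≤ (8 * (2 * ((d : ℝ) + 1)) * c₂)⁻¹ :=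
      rpow_neg_inv_le (by omega) (by positivity) hNb
    calc 2 * ((d : ℝ) + 1) * c₂ * N ^ (-(((2 * d + 1 : ℕ) : ℝ)⁻¹))
        ≤ 2 * ((d : ℝ) + 1) * c₂ * (8 * (2 * ((d : ℝ) + 1)) * c₂)⁻¹ :=
          mul_le_mul_of_nonneg_left hsm (by positivity)
      _ = 1 / 8 := by field_simp
  have hterm2 : a * (N ^ (d + 1))⁻¹ * c₂ ≤ 1 / 4 := by
    have h1 : (N ^ (d + 1))⁻¹ ≤ N⁻¹ := by
      refine inv_anti₀ hN0 ?_
      exact le_self_pow₀ hN1 (by omega)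
    calc a * (N ^ (d + 1))⁻¹ * c₂ ≤ a * N⁻¹ * c₂ := by gcongr
      _ = (a * c₂) / N := by field_simp
      _ ≤ 1 / 4 := by rw [div_le_iff₀ hN0]; linarith
  linarith

/-- the two typed bounds on a member with `m² = 0` feed `core_ineq`: `1 ≤ 2(d+1)·n·(n^{d+1})^t·c₂η^{d+1} + aη^{d+1}c₂`.
[folklore] -/
theorem member_core (a : ℝ) (ha : 0 < a) (i : BoxInst d ℓ m2plus) (hm0 : i.m2 = 0) {c₂ t : ℝ} (ht : 0 < t)
    (x₀ : ↥(toZFC i).R) {N : ℝ} (hN : ((toZFC i).n : ℝ) = N)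
    (hA : (toZFC i).lpN 1 ((toZFC i).opY a 0 0 (Pi.single x₀ 1)) ≤ c₂ * (toZFC i).lpN 1 (Pi.single x₀ 1))
    (hB : ∀ μ : Fin (d + 1),
      (toZFC i).lpN t ((toZFC i).opY a 1 μ (Pi.single x₀ 1)) ≤ c₂ * (toZFC i).lpN 1 (Pi.single x₀ 1)) :
    1 ≤ 2 * ((d : ℝ) + 1) * N * ((N ^ (d + 1)) ^ t * (c₂ * (1 / N) ^ (d + 1))) + a * (N ^ (d + 1))⁻¹ * c₂ := by
  obtain ⟨hS, hBB⟩ := extract a (toZFC i) ht x₀ hA hB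
  have hG : (toZFC i).green a = (boxOpR ((ℓ + 1) ^ i.k) a 0 i.M)⁻¹ := by rw [green_eq_box, hm0]
  rw [hG] at hS hBB
  rw [toZFC_n] at hBB hN
  rw [← hN]
  exact core_ineq (d := d) (n := (ℓ + 1) ^ i.k) (M := i.M) (BoxInst.one_le_Lk ℓ i.k) ha i.hM x₀ hBB hS

/-- **CONJUNCT 2 OF `B4.Lemma22Printed` WITH A DIMENSION PARAMETER `d' ≤ d` IS FALSE ON THE ZERO-FIELD BOX FAMILY**
(`d ≥ 1`, i.e. lattice dimension `d + 1 ≥ 2`): at `p₁ = d + 1/2 ∈ (d', d+1)` no constant `c₂` serves all scales —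
for the cube of one large block with `m² = 0` at scale `k` and the delta function `f = δ_0`, the clause at
`(1/p, 1/q) = (1, 1)` for `G_k` and at `(1, 1 − 1/p₁)` for `D^η_μ G_k` would give `Σ_y|G_k(y,0)| ≤ c₂` and
`|(D^η_μ G_k δ_0)(x)| ≤ c₂ L^{-k(d+1)/p₁}`, whence `1 ≤ 2(d+1)c₂ L^{-k/(2d+1)} + a c₂ L^{-k(d+1)} ≤ 1/2` for `k` large
by the row `0` of `(−Δ^{η,N}_□ + aP_k)G_k = 1` (`core_ineq`, `numerics`).
[cite: Balaban1983RegularityDecay, Lemma 2.2 (2.17) p. 578 with «p₁ > d», case Ã = 0: sharpness of the exponent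
condition, dictionary] [folklore] -/
theorem not_lemma22Printed17_cubeFam (hd : 1 ≤ d) (hℓ : 1 ≤ ℓ) {a : ℝ} (ha : 0 < a) (hm2 : 0 ≤ m2plus)
    {Mb K : ℕ} (hMb : 1 ≤ Mb) (hK : 1 ≤ K) {d' : ℕ} (hd' : d' ≤ d) :
    ¬ (∀ p₁ : ℝ, (d' : ℝ) < p₁ → ∃ c₂ e₁ : ℝ, 0 < c₂ ∧ 0 < e₁ ∧ ∀ i : BoxInst d ℓ m2plus,
        (cubeFam ℓ m2plus a Mb K i).rect → (cubeFam ℓ m2plus a Mb K i).fewLargeBlocks →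
        (cubeFam ℓ m2plus a Mb K i).regular → (cubeFam ℓ m2plus a Mb K i).constNearBdry →
        0 < (cubeFam ℓ m2plus a Mb K i).e → (cubeFam ℓ m2plus a Mb K i).e ≤ e₁ →
        ∀ (s t : ℝ) (n : Fin 3) (μ : (cubeFam ℓ m2plus a Mb K i).Dir) (f : (cubeFam ℓ m2plus a Mb K i).Src),
          0 ≤ t → s ≤ 1 → s - 1 / p₁ ≤ t → t ≤ s →
          (cubeFam ℓ m2plus a Mb K i).opLq n μ t f ≤ c₂ * (cubeFam ℓ m2plus a Mb K i).lpNorm s f) := by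
  intro h
  -- the exponent `p₁ = d + 1/2 ∈ (d', d + 1)` and `t = 1 − 1/p₁ ∈ (0, 1]`
  have hdR : (1 : ℝ) ≤ d := by exact_mod_cast hd
  have hd'R : (d' : ℝ) ≤ d := by exact_mod_cast hd'
  have hp : (d' : ℝ) < (d : ℝ) + 1 / 2 := by linarith
  have hp0 : (0 : ℝ) < (d : ℝ) + 1 / 2 := by positivity
  have ht0 : (0 : ℝ) < 1 - 1 / ((d : ℝ) + 1 / 2) := by
    rw [sub_pos, div_lt_one hp0]; linarith
  have ht1 : 1 - 1 / ((d : ℝ) + 1 / 2) ≤ (1 : ℝ) := by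
    rw [sub_le_self_iff]; positivity
  obtain ⟨c₂, e₁, hc, he, H⟩ := h ((d : ℝ) + 1 / 2) hp
  -- the scale `k`: `L^k ≥ max(4ac₂, (16(d+1)c₂)^{2d+1})`
  obtain ⟨k, hk, hkN⟩ := exists_scale hℓ (max (4 * a * c₂) ((8 * (2 * ((d : ℝ) + 1)) * c₂) ^ (2 * d + 1)))
  have hLk : 1 ≤ (ℓ + 1) ^ k := BoxInst.one_le_Lk ℓ k
  have hN1 : (1 : ℝ) ≤ (((ℓ + 1) ^ k : ℕ) : ℝ) := by exact_mod_cast hLk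
  have hNa : 4 * a * c₂ ≤ (((ℓ + 1) ^ k : ℕ) : ℝ) := le_trans (le_max_left _ _) hkN
  have hNb : (8 * (2 * ((d : ℝ) + 1)) * c₂) ^ (2 * d + 1) ≤ (((ℓ + 1) ^ k : ℕ) : ℝ) :=
    le_trans (le_max_right _ _) hkN
  -- the member: the cube of one large block at scale `k`, mass `0`, charge `e₁`; the corner `x₀ = 0`
  obtain ⟨hrect, hfew, hreg, hcn, he0, he1⟩ := cube_hypothesesC (d := d) (ℓ := ℓ) hm2 a hMb hK k hk he
  have hx₀ : (fun _ : Fin (d + 1) => (0 : ℤ)) ∈ (toZFC (BoxInst.cube (d := d) ℓ hm2 k hk Mb hMb e₁)).R := by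
    rw [toZFC_R, mem_boxDom]
    intro j
    refine ⟨le_rfl, ?_⟩
    have h1 : 1 ≤ (ℓ + 1) ^ k * Mb := Nat.one_le_iff_ne_zero.mpr (Nat.mul_ne_zero (by omega) (by omega))
    exact_mod_cast h1
  -- the two typed bounds on `δ_{x₀}` feed the core inequality …
  have key := member_core (d := d) a ha (BoxInst.cube (d := d) ℓ hm2 k hk Mb hMb e₁) rfl ht0 ⟨_, hx₀⟩ rfl
    (H _ hrect hfew hreg hcn he0 he1 1 1 0 (show Fin (d + 1) from 0) (Pi.single ⟨_, hx₀⟩ 1) zero_le_one le_rfl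
      (by rw [sub_le_self_iff]; positivity) le_rfl)
    (fun μ => H _ hrect hfew hreg hcn he0 he1 1 (1 - 1 / ((d : ℝ) + 1 / 2)) 1 μ (Pi.single ⟨_, hx₀⟩ 1) ht0.le
      le_rfl le_rfl ht1)
  -- … which the numerics contradict
  have hnum := numerics d ha hc hN1 hNa hNb
  exact absurd (lt_of_le_of_lt key hnum) (lt_irrefl _)

/-- hence the TYPED LEAF with a parameter `d' ≤ d` is false on the zero-field box family. [folklore] -/
theorem not_lemma22Printed_cubeFam (hd : 1 ≤ d) (hℓ : 1 ≤ ℓ) {a : ℝ} (ha : 0 < a) (hm2 : 0 ≤ m2plus)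
    {Mb K : ℕ} (hMb : 1 ≤ Mb) (hK : 1 ≤ K) {d' : ℕ} (hd' : d' ≤ d) :
    ¬ Lemma22Printed (cubeFam (d := d) ℓ m2plus a Mb K) d' := fun h =>
  not_lemma22Printed17_cubeFam hd hℓ ha hm2 hMb hK hd' ((lemma22Printed_iff _ _).1 h).2

/-- **THE TYPED LEMMA 2.2 LEAF ON THE ZERO-FIELD BOX FAMILY, DECIDED IN ITS DIMENSION PARAMETER**: for lattice
dimension `d + 1 ≥ 2` it holds EXACTLY for `d' ≥ d + 1` — the print's «p₁ > d» (d = the number of dimensions of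
the lattice `ηℤ^d`, here `d + 1`) cannot be weakened. [cite: Balaban1983RegularityDecay, Lemma 2.2 (2.16)–(2.17)
pp. 577–578, case Ã = 0, □ a box: the exponent condition is sharp] -/
theorem lemma22Printed_cubeFam_iff (hd : 1 ≤ d) (hℓ : 1 ≤ ℓ) {a : ℝ} (ha : 0 < a) (hm2 : 0 ≤ m2plus)
    {Mb K : ℕ} (hMb : 1 ≤ Mb) (hK : 1 ≤ K) (d' : ℕ) :
    Lemma22Printed (cubeFam (d := d) ℓ m2plus a Mb K) d' ↔ d + 1 ≤ d' := by
  refine ⟨fun h => ?_, fun h => lemma22Printed_cubeFam_of_le hℓ a ha Mb K h⟩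
  by_contra hlt
  exact not_lemma22Printed_cubeFam hd hℓ ha hm2 hMb hK (by omega) h

end Refutation

/-! ## §7 Instances: `d + 1 = 4`, `L = 2`, `m²₊ = 1`, `a = 1`, `Mb = 5`, `K = 1` -/

section Instances

/-- the typed leaf with the package index `d = 3` as its parameter is FALSE on the zero-field box family of the
four-dimensional lattice … [folklore] -/
example : ¬ Lemma22Printed (cubeFam (d := 3) (m2plus := 1) 1 1 5 1) 3 :=
  not_lemma22Printed_cubeFam (d := 3) (Mb := 5) (K := 1) (d' := 3) (by norm_num) le_rfl one_pos zero_le_one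
    (by norm_num) le_rfl le_rfl

/-- … it is TRUE with the lattice dimension `4` (node 19) … [folklore] -/
example : Lemma22Printed (cubeFam (d := 3) (m2plus := 1) 1 1 5 1) 4 :=
  lemma22Printed_cubeFam_of_le le_rfl 1 one_pos 5 1 le_rfl

/-- … and decided for every parameter. [folklore] -/
example (d' : ℕ) : Lemma22Printed (cubeFam (d := 3) (m2plus := 1) 1 1 5 1) d' ↔ 4 ≤ d' :=
  lemma22Printed_cubeFam_iff (d := 3) (Mb := 5) (K := 1) (by norm_num) le_rfl one_pos zero_le_one (by norm_num)
    le_rfl d'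

end Instances

end

end Literature.MathematicalPhysics.QuantumFieldTheory.Balaban1983to89.B4Lemma22ZeroBoxSharp
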